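import Literature.Computability.AlgebraicComplexity.HomogeneousComponentsComplexity
import Literature.Computability.AlgebraicComplexity.ConstantFreeCircuits
import HarnessLib

/-!
# Guo–Kumar–Saptharishi–Solomon 2019, Lemma 20: partial homogenisation — grafting a circuit onto
# homogeneous data inside one growing gate list

Cell `val-lit`, seat t19 (literature-prover); groundwork for the discharge programme of
`GKSS2019_mainThm` (v2, erratum A34) along the printed proof of [GKSS19, §3]. THEOREM-ONLY (no
definitions, no named facts); nothing here bears on `VP ≠ VNP`, which is NOT proved.

Source: Z. Guo, M. Kumar, R. Saptharishi, N. Solomon, *Derandomization from algebraic hardness*,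
SIAM J. Comput. 51 (2022) = arXiv:1905.00091 [GuoKumarSaptharishiSolomon2019], §2.3 Lemma 20
"Partial homogenisation" with its proof (held text `paper:arxiv-1905.00091`, p0010.txt:L24–L37).

## What is here

Printed Lemma 20: "Let `C` be a multi-output homogeneous circuit of size `s` computing
`f_1, …, f_m`. Suppose `C'` is a multi-output, `m`-input circuit of size `s'`. Then there is a
homogeneous circuit `D` of size at most `s + O(s'·d²)` computing `C' ∘ C`", proved by the standard
gate-by-gate homogenisation "applied only to the circuit `C'`". In the tree's shared-gate-list
formalism (`HrubesSensitiveMonotoneProofs.lean`, namespace `Hrubes2020`: "`p` is available in the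
plain fan-in-two gate list `gs`"; `HomogeneousComponentsComplexity.lean`: the homogenisation steps
`hc_gate`, `hc_operand`, …), the multi-output circuit `C` is the ambient gate list `gs` in which the
homogeneous components (of degree `≤ d`) of the substituted inputs `h_1, …, h_r` are available, and
the statement becomes:

* `hc_graft` — for every list `cs` of fan-in-two gates over the input variables `Fin r`, at most
  `(d+2)² · |cs|` new PLAIN fan-in-two gates appended to `gs` make every homogeneous component of
  degree `≤ d` of every value of `cs` UNDER THE SUBSTITUTION `x_i ↦ h_i` available;
* `hc_graft_eval` — the same for the output `C'(h_1, …, h_r)` of a fan-in-two circuit `C'`;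
* `hc_graft_complexity` — with `(d+2)² · L(f)` gates for any `f` and its minimal circuit.

The proof is the printed one: the gates of `C'` are translated (`Gate.subst`, reading the inputs
off a value list `h_1, …, h_r` placed in front of the translated values —
`ConstantFreeCircuits.lean`'s substitution semantics `Gate.eval_subst`) and homogenised one at a
time by `hc_gate`; additive size `|gs| + (d+2)²·s'` as printed (`(d+2)²` for the print's `O(d²)`).

## References
* [GuoKumarSaptharishiSolomon2019] arXiv:1905.00091, Lemma 20 and proof (p0010.txt:L24–37).
* [BurgisserClausenShokrollahi1997] Lemma (21.25) (the homogenisation recursion, tree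
  `HomogeneousComponentsComplexity.lean`).
-/

noncomputable section

namespace Literature.Computability.AlgebraicComplexity

open MvPolynomial Literature.Barriers.ValiantsHypothesis

universe u v

namespace ArithCircuit

namespace Homogenisation

variable {k : Type u} [CommSemiring k] {σ : Type v}

/-- Reading the `i`-th input off a value list placed in front. [cite: GuoKumarSaptharishiSolomon2019, Lemma 20 proof (arXiv p0010.txt:L30-37), "any leaf … labeled with the `i`-th variable"] -/
private theorem eval_gate_ofFn {r : ℕ} (h : Fin r → MvPolynomial σ k) (i : Fin r)
    (ws : List (MvPolynomial σ k)) :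
    (Operand.gate (k := k) (σ := σ) i.val).eval (List.ofFn h ++ ws) = h i := by
  simp only [Operand.eval, List.getD_eq_getElem?_getD]
  rw [List.getElem?_append_left (by simp), List.getElem?_ofFn]
  simp

/-- **Partial homogenisation, gate-list form (GKSS Lemma 20).** Let `gs` be a plain fan-in-two
gate list in which all homogeneous components of degree `≤ d` of `h_1, …, h_r` are available, and
let `cs` be any list of fan-in-two gates over the inputs `x_1, …, x_r`. Appending at most
`(d+2)² · |cs|` plain fan-in-two gates makes every homogeneous component of degree `≤ d` of every
value of `cs` under `x_i ↦ h_i` available ("replace each gate `g ∈ C'` by copies `g_0, …, g_d` …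
a homogeneous circuit for `C' ∘ C` of size at most `s + O(s' d²)`").
[cite: GuoKumarSaptharishiSolomon2019, Lemma 20 (arXiv p0010.txt:L24-37)] -/
theorem hc_graft {gs : List (Gate k σ)} (hgs : ∀ g ∈ gs, g.fanIn ≤ 2 ∧ IsPlainGate g) {d r : ℕ}
    (h : Fin r → MvPolynomial σ k)
    (hin : ∀ i, ∀ e ≤ d, ∃ u : Operand k σ, u.RefsBelow gs.length ∧
      u.eval (gateValues gs) = homogeneousComponent e (h i))
    (cs : List (Gate k (Fin r))) (hcs : ∀ g ∈ cs, g.fanIn ≤ 2) :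
    ∃ gs' : List (Gate k σ), gs <+: gs' ∧ (∀ g ∈ gs', g.fanIn ≤ 2 ∧ IsPlainGate g) ∧
      gs'.length ≤ gs.length + (d + 2) ^ 2 * cs.length ∧
      ∀ v ∈ gateValues cs, ∀ e ≤ d, ∃ u : Operand k σ, u.RefsBelow gs'.length ∧
        u.eval (gateValues gs') = homogeneousComponent e (aeval h v) := by
  induction cs using List.reverseRecOn with
  | nil =>
    exact ⟨gs, List.prefix_rfl, hgs, by simp, fun v hv => by simp [gateValues] at hv⟩
  | append_singleton cs g ih =>
    obtain ⟨gs₁, hp₁, hg₁, hl₁, hr₁⟩ := ih (fun g' hg' => hcs g' (by simp [hg']))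
    -- the value list read by the translated gate: inputs first, then the translated values
    set pre : List (MvPolynomial σ k) := List.ofFn h with hpre
    set vals : List (MvPolynomial σ k) := pre ++ (gateValues cs).map (aeval h) with hvals
    set ρ : Fin r → Operand k σ := fun i => Operand.gate i.val with hρ
    have hρh : ∀ i ws, (ρ i).eval (pre ++ ws) = h i := fun i ws => eval_gate_ofFn h i ws
    have havail : ∀ v ∈ vals, ∀ e ≤ d, ∃ u : Operand k σ, u.RefsBelow gs₁.length ∧
        u.eval (gateValues gs₁) = homogeneousComponent e v := by
      intro v hv
      rw [hvals, List.mem_append] at hv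
      rcases hv with hv | hv
      · rw [hpre, List.mem_ofFn] at hv
        obtain ⟨i, rfl⟩ := hv
        exact hc_mono hp₁ (hin i)
      · rw [List.mem_map] at hv
        obtain ⟨w, hw, rfl⟩ := hv
        exact hr₁ w hw
    obtain ⟨gs₂, hp₂, hg₂, hl₂, hr₂⟩ :=
      hc_gate hg₁ vals havail (g.subst ρ pre.length) (by rw [Gate.fanIn_subst]; exact hcs g (by simp))
    have hval : (g.subst ρ pre.length).eval vals = aeval h (g.eval (gateValues cs)) := by
      rw [hvals]
      exact Gate.eval_subst hρh g (gateValues cs)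
    refine ⟨gs₂, hp₁.trans hp₂, hg₂, ?_, ?_⟩
    · calc gs₂.length ≤ gs₁.length + (d + 2) ^ 2 := hl₂
        _ ≤ gs.length + (d + 2) ^ 2 * cs.length + (d + 2) ^ 2 := Nat.add_le_add_right hl₁ _
        _ = gs.length + (d + 2) ^ 2 * (cs ++ [g]).length := by
          simp [Nat.mul_succ, Nat.add_assoc]
    · intro v hv
      rw [gateValues_append_singleton, List.mem_append, List.mem_singleton] at hv
      rcases hv with hv | rfl
      · exact hc_mono hp₂ (hr₁ v hv)
      · rw [← hval]
        exact hr₂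

/-- **Lemma 20 for a circuit's output**: with `C'` a fan-in-two circuit over `x_1, …, x_r`, at most
`(d+2)² · |C'|` plain fan-in-two gates appended to `gs` make the homogeneous components of degree
`≤ d` of `C'(h_1, …, h_r)` available. [cite: GuoKumarSaptharishiSolomon2019, Lemma 20 (arXiv p0010.txt:L24-37)] -/
theorem hc_graft_eval {gs : List (Gate k σ)} (hgs : ∀ g ∈ gs, g.fanIn ≤ 2 ∧ IsPlainGate g) {d r : ℕ}
    (h : Fin r → MvPolynomial σ k)
    (hin : ∀ i, ∀ e ≤ d, ∃ u : Operand k σ, u.RefsBelow gs.length ∧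
      u.eval (gateValues gs) = homogeneousComponent e (h i))
    (Q : ArithCircuit k (Fin r)) (hQ : Q.IsFanInTwo) :
    ∃ gs' : List (Gate k σ), gs <+: gs' ∧ (∀ g ∈ gs', g.fanIn ≤ 2 ∧ IsPlainGate g) ∧
      gs'.length ≤ gs.length + (d + 2) ^ 2 * Q.size ∧
      ∀ e ≤ d, ∃ u : Operand k σ, u.RefsBelow gs'.length ∧
        u.eval (gateValues gs') = homogeneousComponent e (aeval h Q.eval) := by
  obtain ⟨gs', hp, hg, hl, hr⟩ := hc_graft hgs h hin Q.gates hQ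
  refine ⟨gs', hp, hg, hl, ?_⟩
  set pre : List (MvPolynomial σ k) := List.ofFn h with hpre
  set vals : List (MvPolynomial σ k) := pre ++ (gateValues Q.gates).map (aeval h) with hvals
  set ρ : Fin r → Operand k σ := fun i => Operand.gate i.val with hρ
  have hρh : ∀ i ws, (ρ i).eval (pre ++ ws) = h i := fun i ws => eval_gate_ofFn h i ws
  have havail : ∀ v ∈ vals, ∀ e ≤ d, ∃ u : Operand k σ, u.RefsBelow gs'.length ∧
      u.eval (gateValues gs') = homogeneousComponent e v := by
    intro v hv
    rw [hvals, List.mem_append] at hv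
    rcases hv with hv | hv
    · rw [hpre, List.mem_ofFn] at hv
      obtain ⟨i, rfl⟩ := hv
      exact hc_mono hp (hin i)
    · rw [List.mem_map] at hv
      obtain ⟨w, hw, rfl⟩ := hv
      exact hr w hw
  have hval : (Q.output.subst ρ pre.length).eval vals = aeval h Q.eval := by
    rw [hvals]
    exact Operand.eval_subst hρh Q.output (gateValues Q.gates)
  have := hc_operand gs' d vals havail (Q.output.subst ρ pre.length)
  rw [hval] at this
  exact this

/-- **Lemma 20 with the minimal circuit**: `(d+2)² · L(f)` appended plain fan-in-two gates make the
homogeneous components of degree `≤ d` of `f(h_1, …, h_r)` available in a gate list in which those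
of the `h_i` are. [cite: GuoKumarSaptharishiSolomon2019, Lemma 20 (arXiv p0010.txt:L24-37)] -/
theorem hc_graft_complexity {gs : List (Gate k σ)} (hgs : ∀ g ∈ gs, g.fanIn ≤ 2 ∧ IsPlainGate g)
    {d r : ℕ} (h : Fin r → MvPolynomial σ k)
    (hin : ∀ i, ∀ e ≤ d, ∃ u : Operand k σ, u.RefsBelow gs.length ∧
      u.eval (gateValues gs) = homogeneousComponent e (h i))
    (f : MvPolynomial (Fin r) k) :
    ∃ gs' : List (Gate k σ), gs <+: gs' ∧ (∀ g ∈ gs', g.fanIn ≤ 2 ∧ IsPlainGate g) ∧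
      gs'.length ≤ gs.length + (d + 2) ^ 2 * complexity f ∧
      ∀ e ≤ d, ∃ u : Operand k σ, u.RefsBelow gs'.length ∧
        u.eval (gateValues gs') = homogeneousComponent e (aeval h f) := by
  obtain ⟨Q, hQ1, hQ2, hQ3⟩ := exists_computes_size_eq_complexity f
  obtain ⟨gs', hp, hg, hl, hr⟩ := hc_graft_eval hgs h hin Q hQ1
  rw [hQ3] at hl
  rw [show Q.eval = f from hQ2] at hr
  exact ⟨gs', hp, hg, hl, hr⟩

end Homogenisation

end ArithCircuit

end Literature.Computability.AlgebraicComplexity
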